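import Summits.ABC.IUTFork.Cor312PinnedCountermodel
import Summits.ABC.IUTFork.Cor312PilotKummerCompatNonVacuity
import Summits.ABC.IUTFork.Cor312PilotKummerCompatSubStatement
import Summits.ABC.IUTFork.Cor312PinnedLogShellOneRho
import Summits.ABC.IUTFork.Cor312PinnedFrameFlip
import Summits.ABC.IUTFork.Cor312PinnedGapNotNecessary
import HarnessLib

/-!
# IUT REPAIR branch (rung LADDER-ABC:A2.RP) — rp-cx pre-evaluation of the INTERNAL candidate shapes RP-I01 / RP-I02 / RP-I04

Record-only file (D-0012) of the abc-iut cell, seat abc-iut-rp-cx (T-b/T-c engine of the IUT REPAIR branch, REPAIR-SPEC v0 §3/§4).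
TAKES NO SIDE on [IUTchIII] Cor. 3.12; proof-only (the three `def`s below are the candidate SHAPES of CANDIDATES.tsv rows RP-I01,
RP-I02, RP-I04 verbatim, as HYPOTHESES — `Prop`-valued definitions, never asserted; typed ≠ proved; instantiated ≠ endorsed).

For each shape `H`: **T-b** = `H` is FALSE at the pinned countermodel of record (abc-iut-w4-d101's `pinnedSetting p` over
abc-iut-w5-d247's `naiveFull p`, operator `orbitRegion p`, q-datum `qDatum p`; every prime `p`, in particular `p = 2`) — the
EXPECTED polarity «FAILS-AT-CM»; **T-c** = `H` HOLDS at the link-identified corner P♭ (`linkIdSetting p`, `ballOfMonoid p`, datum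
`Ψ`), where typed Thm. 3.11, `BridgeHyps`, `AbsLogQPos`, `PinnedRegions3`, the residual `PilotKummerIndRelated` and the Statement all
hold (`NaiveWitness.linkId_*`, p420952) — grade SAT0 (degenerate corner: the q-datum IS the Θ-datum). T-a for these shapes is in the
tree (`pilotKummerIndRelated_of_linkedGlue`, `pilotKummerCompat_iff_link` + `statement_of_pilotKummerCompat`, `statement_of_subDatum`).
[claim: Mochizuki2012, status: disputed] [cite: ScholzeStix2018, §2.2 pp. 9–10]
-/

noncomputable section

namespace Summit.ABC.IUTFork.Repair.EvalInternal

open Thm311 Cor312 Cor312.Checks Cor312.IdentifiedNonVacuity Cor312Vol Literature.IUT.LogThetaLattice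
open Cor312Vol.NaiveWitness Cor312Vol.PinnedWitness Cor312Vol.PinnedHonest

variable {T : ThetaIndex}

/-! ## RP-I01 — LINK-FAITHFUL GLUE (b2′) -/

/-- CANDIDATE SHAPE RP-I01 (class Internal, sub-cell B0) — hypothesis, NOT asserted; typed ≠ proved. [IUTchIII] Step (xi-a) p. 181
l. 33–44 + Thm. 3.11 (iii)(c) final clause: «the q-pilot's Kummer-image REGION at `(n+1)`, read through the link, is the region of the
column-`(n−1)` Θ-pilot Frobenius–Kummer datum at some `m₀`». LEVEL R. [claim: Mochizuki2012, status: disputed] -/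
@[claim "Mochizuki2012" "disputed"] def HGlue (S : LatticeSituation T) (P : Cor312.Setting S.toSituation)
    (ρ : (∀ v : T.V, v ∈ T.Vbad → Set (S.L.StarPacket v)) → ∀ (j : T.Label) (vQ : T.VQ), Set (S.L.Packet j vQ))
    (qK : ∀ v : T.V, v ∈ T.Vbad → Set (S.L.StarPacket v)) : Prop :=
  ∃ m₀ : ℤ, ∀ (j : T.Label) (vQ : T.VQ), ρ qK j vQ = ρ ((S.col (P.n - 1)).frobΨ m₀) j vQ

/-! ## RP-I02 — DATUM-LEVEL LINK TRANSPORT (L)+(LI) -/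

/-- CANDIDATE SHAPE RP-I02 (class Internal, sub-cell B0) — hypothesis, NOT asserted. [IUTchIII] (xi-a) p. 181 l. 36–41, (xi-d) p. 183
l. 2–8: «the q-datum is an ⟨(Ind1) ∪ (Ind2)⟩-translate of the column-`n` Θ-datum». LEVEL C (≡ `PilotKummerCompat` under Thm. 3.11
(ii)(b), `hLink_iff_pilotKummerCompat`). [claim: Mochizuki2012, status: disputed] -/
@[claim "Mochizuki2012" "disputed"] def HLink (S : LatticeSituation T) (P : Cor312.Setting S.toSituation)
    (qK : ∀ v : T.V, v ∈ T.Vbad → Set (S.L.StarPacket v)) : Prop :=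
  ∃ Φ₀ ∈ Subgroup.closure (S.L.Ind1Family ∪ S.L.Ind2Family),
    ∀ (v : T.V) (hv : v ∈ T.Vbad), qK v hv = S.L.starAut Φ₀ v '' (S.D P.n).Ψ v hv

/-! ## RP-I04 — INCLUSION FORM -/

/-- CANDIDATE SHAPE RP-I04 (class Internal, sub-cell B0) — hypothesis, NOT asserted. [IUTchIII] Thm. 3.11 (iii)(c) p. 158 l. 5–15 read
as upper semi-containment: «the q-datum lies INSIDE an indeterminacy-translate of a column-`n` Θ-pilot Kummer image». LEVEL H (via the
hull, `statement_of_subDatum` p424841). [claim: Mochizuki2012, status: disputed] -/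
@[claim "Mochizuki2012" "disputed"] def HIncl (S : LatticeSituation T) (P : Cor312.Setting S.toSituation)
    (qK : ∀ v : T.V, v ∈ T.Vbad → Set (S.L.StarPacket v)) : Prop :=
  ∃ Φ ∈ Subgroup.closure (S.L.Ind1Family ∪ S.L.Ind2Family), ∃ m : ℤ,
    ∀ (v : T.V) (hv : v ∈ T.Vbad), qK v hv ⊆ S.L.starAut Φ v '' (S.col P.n).frobΨ m v hv

section General

variable (S : LatticeSituation T) (P : Cor312.Setting S.toSituation)
  (qK : ∀ v : T.V, v ∈ T.Vbad → Set (S.L.StarPacket v))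

/-- RP-I02 IS the datum-level clause `PilotKummerCompat` under Thm. 3.11 (ii)(b) for column `n` (abc-iut-w5-d147's
`pilotKummerCompat_iff_link`): the row RESTATES level C. [claim: Mochizuki2012, status: disputed] -/
theorem hLink_iff_pilotKummerCompat (hKumB : (S.col P.n).KummerB (S.D P.n)) :
    HLink S P qK ↔ PilotKummerCompat S P qK :=
  (pilotKummerCompat_iff_link S P qK hKumB).symm

/-- Level C ⟹ the inclusion form (trivially). [folklore] -/
theorem hIncl_of_pilotKummerCompat (h : PilotKummerCompat S P qK) : HIncl S P qK := by
  obtain ⟨Φ, hΦ, m, hm⟩ := h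
  exact ⟨Φ, hΦ, m, fun v hv => (hm v hv).le⟩

end General

section Models

variable (p : ℕ) [hp : Fact p.Prime]

/-! ## T-b: all three shapes FAIL at the pinned countermodel (every prime `p`) -/

/-- **T-b (RP-I01): FAILS-AT-CM.** At label `2` the q-datum's region is `B_1 = q·𝒪` while the region of any column's Frobenius-like
Θ-monoid `Ψ` is `B_4 = q⁴·𝒪`. [folklore] -/
theorem hGlue_fails_at_CM :
    ¬ HGlue (naiveFull p).toLatticeSituation (pinnedSetting p) (orbitRegion p) (qDatum p) := by
  rintro ⟨m₀, h⟩
  have h2 := h 2 ()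
  rw [naiveFull_frobΨ, orbitRegion_qDatum p (by decide), orbitRegion_Psi] at h2
  have hj : jsq (2 : toyIndex.Label) = 4 := by decide
  rw [hj] at h2
  have := pBall_injective p 2 () h2
  omega

/-- **T-b (RP-I02): FAILS-AT-CM** (≡ `not_pilotKummerCompat_pinnedSetting`, p420303). [folklore] -/
theorem hLink_fails_at_CM : ¬ HLink (naiveFull p).toLatticeSituation (pinnedSetting p) (qDatum p) := fun h =>
  not_pilotKummerCompat_pinnedSetting p ((hLink_iff_pilotKummerCompat _ _ _ (GluedMonoids.Naive.naive_kummerB p _)).1 h)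

/-- **T-b (RP-I04): FAILS-AT-CM.** An indeterminacy acts by signs, so a translate of `Ψ = {(±q^{j²})_j}` is `Ψ`; the tuple `(q)_j` of the
q-datum would then have label-2 component `±q⁴` (abc-iut-w5-d246's `not_isThetaType_qDatum`). [folklore] -/
theorem hIncl_fails_at_CM : ¬ HIncl (naiveFull p).toLatticeSituation (pinnedSetting p) (qDatum p) := by
  rintro ⟨Φ, hΦ, m, h⟩
  refine not_isThetaType_qDatum p fun v hv ψ hψ => ?_
  have hmem := h v hv hψ
  rw [naiveFull_frobΨ] at hmem
  change ψ ∈ signShells.starAut Φ v '' Psi p v at hmem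
  rw [image_Psi_of_actsBySigns p (actsBySigns_of_mem_closure hΦ)] at hmem
  exact isThetaType_Psi p v hv ψ hmem

/-- The three T-b verdicts at the countermodel OF RECORD (`p = 2`, REPAIR-SPEC §2 item 3). [folklore] -/
theorem internal_shapes_fail_at_CM :
    ¬ HGlue (naiveFull 2).toLatticeSituation (pinnedSetting 2) (orbitRegion 2) (qDatum 2) ∧
      ¬ HLink (naiveFull 2).toLatticeSituation (pinnedSetting 2) (qDatum 2) ∧
      ¬ HIncl (naiveFull 2).toLatticeSituation (pinnedSetting 2) (qDatum 2) :=
  ⟨hGlue_fails_at_CM 2, hLink_fails_at_CM 2, hIncl_fails_at_CM 2⟩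

/-! ## T-c: all three shapes HOLD at P♭ (grade SAT0) -/

/-- **T-c (RP-I01): holds at P♭** with `m₀ = 0` (every column's Frobenius-like Θ-monoid is `Ψ`). [folklore] -/
theorem hGlue_holds_at_linkId :
    HGlue (naiveFull p).toLatticeSituation (linkIdSetting p) (GluedMonoids.Naive.ballOfMonoid p) (fun v _ => Psi p v) :=
  ⟨0, fun j vQ => by rw [naiveFull_frobΨ]⟩

/-- **T-c (RP-I02): holds at P♭** (≡ `linkId_pilotKummerCompat`, p420952). [folklore] -/
theorem hLink_holds_at_linkId : HLink (naiveFull p).toLatticeSituation (linkIdSetting p) (fun v _ => Psi p v) :=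
  (hLink_iff_pilotKummerCompat _ _ _ (GluedMonoids.Naive.naive_kummerB p _)).2 (linkId_pilotKummerCompat p)

/-- **T-c (RP-I04): holds at P♭** (≡ `linkId_subDatum`, p424841). [folklore] -/
theorem hIncl_holds_at_linkId : HIncl (naiveFull p).toLatticeSituation (linkIdSetting p) (fun v _ => Psi p v) :=
  hIncl_of_pilotKummerCompat _ _ _ (linkId_pilotKummerCompat p)

/-- **T-c packaged (REPAIR-SPEC §2 item 4 shape), grade SAT0**: one model of typed Thm. 3.11 ∧ `BridgeHyps` ∧ `AbsLogQPos` ∧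
`PinnedRegions3` where all three shapes hold (together with the residual and the Statement). [folklore] -/
theorem internal_shapes_satisfiable :
    ∃ (T : ThetaIndex) (F : FullSituation T) (P : Cor312.Setting F.toLatticeSituation.toSituation)
      (ρ : (∀ v : T.V, v ∈ T.Vbad → Set (F.L.StarPacket v)) → ∀ (j : T.Label) (vQ : T.VQ), Set (F.L.Packet j vQ))
      (qK : ∀ v : T.V, v ∈ T.Vbad → Set (F.L.StarPacket v)),
      F.Statement ∧ BridgeHyps P ∧ P.AbsLogQPos ∧ PinnedRegions3 F.toLatticeSituation P ρ qK ∧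
        HGlue F.toLatticeSituation P ρ qK ∧ HLink F.toLatticeSituation P qK ∧ HIncl F.toLatticeSituation P qK ∧
        PilotKummerIndRelated F.toLatticeSituation P ρ qK ∧ P.Statement :=
  ⟨toyIndex, naiveFull 2, linkIdSetting 2, GluedMonoids.Naive.ballOfMonoid 2, fun v _ => Psi 2 v, naiveFull_statement 2,
    linkId_bridgeHyps 2, linkId_absLogQPos 2, linkId_pinnedRegions3 2, hGlue_holds_at_linkId 2, hLink_holds_at_linkId 2,
    hIncl_holds_at_linkId 2, linkId_pilotKummerIndRelated 2, linkId_statement_via_PR1 2⟩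

end Models

end Summit.ABC.IUTFork.Repair.EvalInternal

end
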